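import Literature.Analysis.FluidPDE.LaplaceVeryWeakGradient
import Literature.Analysis.FunctionSpaces.MollificationLocal
import Literature.Analysis.FunctionSpaces.MollificationLp
import Literature.Analysis.FunctionSpaces.ContDiffOnLimit
import Literature.Analysis.Calculus.DerivativeInterpolation
import HarnessLib

/-!
# Functions with bounded weak derivatives of all orders are smooth

Analysis/FluidPDE support file (theorems only). On a ball `B(x₀, R) ⊆ ℝ³` let `F γ`
(`γ` a multi-index, a list of coordinate directions) be integrable functions with
`|F γ| ≤ K_{|γ|}` a.e. and the weak-derivative identities `∫ F γ ∂ᵢφ = -∫ F (i :: γ) φ` for all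
test functions `φ` on the ball. Then on every smaller ball `B(x₀, r)` the function `F []` agrees
a.e. with a smooth function `v` all of whose derivatives are bounded, `‖Dᵏv‖ ≤ 3ᵏ K_k`
(`exists_smooth_rep`). This is the elementary regularity statement `⋂ₖ W^{k,∞} = C^∞` with
bounds (Evans, *PDE*, §5.3.1 Thm. 1 (mollification commutes with weak differentiation) and
§5.8.2; Gilbarg–Trudinger §7.2–7.3), proved by mollification: the mollifications are smooth
with `Dᵏ` expressed through the mollified `F γ`, `|γ| = k`, hence bounded uniformly; they are
equi-Lipschitz and converge a.e. along a subsequence, hence everywhere and locally uniformly, and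
all derivatives converge (`Literature.Analysis.Calculus.uniformCauchySeqOn_iteratedFDeriv_of_uniformCauchySeqOn`,
`Literature.Analysis.FunctionSpaces.contDiffOn_infty_of_uniformCauchySeqOn_iteratedFDeriv`).

## References

* L. C. Evans, *Partial Differential Equations*, 2nd ed. (2010), §5.3.1 Thm. 1, §5.8.2.
  [`Evans2010`]
* D. Gilbarg, N. S. Trudinger, *Elliptic PDE of Second Order*, §7.2–7.3. [folklore]
-/

noncomputable section

open MeasureTheory Set Function Filter Topology TopologicalSpace Metric
open scoped NNReal ENNReal RealInnerProductSpace ContDiff Convolution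

namespace Literature.Analysis.FluidPDE

namespace WkInfty

open FunctionSpaces LaplaceVeryWeak

/-- The coordinate frame. [folklore] -/
abbrev e (i : Fin 3) : EuclideanSpace ℝ (Fin 3) := EuclideanSpace.basisFun (Fin 3) ℝ i

/-! ### Norms of multilinear maps through the frame -/

/-- **A multilinear form is bounded by its values on the frame**:
`‖m‖ ≤ Σ_σ |m(e_{σ₁}, …, e_{σ_k})|`. [folklore] -/
theorem norm_multilinear_le_sum_frame {k : ℕ}
    (m : ContinuousMultilinearMap ℝ (fun _ : Fin k => EuclideanSpace ℝ (Fin 3)) ℝ) :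
    ‖m‖ ≤ ∑ σ : Fin k → Fin 3, |m (fun j => e (σ j))| := by
  classical
  refine ContinuousMultilinearMap.opNorm_le_bound (Finset.sum_nonneg fun σ _ => abs_nonneg _) fun h => ?_
  have hexp : ∀ j, h j = ∑ i, h j i • e i := fun j => by
    have h1 := ((EuclideanSpace.basisFun (Fin 3) ℝ).sum_repr' (h j)).symm
    simpa [EuclideanSpace.inner_basisFun_real] using h1
  have e1 : m h = m (fun j => ∑ i, h j i • e i) := by
    congr 1; funext j; exact hexp j
  have e2 : m (fun j => ∑ i, h j i • e i) = ∑ σ : Fin k → Fin 3, m (fun j => h j (σ j) • e (σ j)) :=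
    MultilinearMap.map_sum m.toMultilinearMap (fun j i => h j i • e i)
  rw [e1, e2]
  refine (norm_sum_le _ _).trans ?_
  rw [Finset.sum_mul]
  refine Finset.sum_le_sum fun σ _ => ?_
  rw [ContinuousMultilinearMap.map_smul_univ, Real.norm_eq_abs, smul_eq_mul, abs_mul, mul_comm]
  refine mul_le_mul_of_nonneg_left ?_ (abs_nonneg _)
  rw [Finset.abs_prod]
  exact Finset.prod_le_prod (fun j _ => abs_nonneg _) fun j _ => by
    simpa [Real.norm_eq_abs] using PiLp.norm_apply_le (h j) (σ j)


/-! ### The setting -/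

section Setting

variable {x₀ : EuclideanSpace ℝ (Fin 3)} {R : ℝ} {F : List (Fin 3) → EuclideanSpace ℝ (Fin 3) → ℝ} {K : ℕ → ℝ≥0}

/-- The ball as an open set. [folklore] -/
abbrev B (x₀ : EuclideanSpace ℝ (Fin 3)) (R : ℝ) : Opens (EuclideanSpace ℝ (Fin 3)) := ⟨ball x₀ R, isOpen_ball⟩

/-- The underlying set of `B`. [folklore] -/
theorem coe_B (x₀ : EuclideanSpace ℝ (Fin 3)) (R : ℝ) : ((B x₀ R : Opens (EuclideanSpace ℝ (Fin 3))) : Set (EuclideanSpace ℝ (Fin 3))) = ball x₀ R := rfl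

set_option maxHeartbeats 800000 in
/-- **The coordinate identities give a weak Fréchet derivative**: if
`∫ F γ ∂ᵢφ = -∫ F (i :: γ) φ` for all test functions and all `i`, then `F γ` has the weak
derivative `y ↦ Σᵢ F (i :: γ) y • projᵢ` on the ball. [folklore] -/
theorem hasWeakFDerivOn_of_coords (hint : ∀ γ, IntegrableOn (F γ) (ball x₀ R))
    (hweak : ∀ (γ : List (Fin 3)) (i : Fin 3) (φ : EuclideanSpace ℝ (Fin 3) → ℝ), IsTestFunctionOn (B x₀ R) φ →
      ∫ x in ball x₀ R, F γ x * fderiv ℝ φ x (e i) = -∫ x in ball x₀ R, F (i :: γ) x * φ x)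
    (γ : List (Fin 3)) :
    HasWeakFDerivOn (B x₀ R) volume (F γ)
      (fun y => ∑ i, F (i :: γ) y • (EuclideanSpace.proj i : EuclideanSpace ℝ (Fin 3) →L[ℝ] ℝ)) := by
  have hgi : Integrable (fun y => ∑ i, F (i :: γ) y • (EuclideanSpace.proj i : EuclideanSpace ℝ (Fin 3) →L[ℝ] ℝ))
      (volume.restrict (ball x₀ R)) :=
    integrable_finsetSum Finset.univ
      (f := fun i y => F (i :: γ) y • (EuclideanSpace.proj i : EuclideanSpace ℝ (Fin 3) →L[ℝ] ℝ))
      fun i _ => (hint (i :: γ)).smul_const (EuclideanSpace.proj i : EuclideanSpace ℝ (Fin 3) →L[ℝ] ℝ)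
  refine ⟨(hint γ).locallyIntegrableOn, IntegrableOn.locallyIntegrableOn hgi, fun φ v hφ => ?_⟩
  have hv : v = ∑ i, v i • e i := by
    have h1 := (EuclideanSpace.basisFun (Fin 3) ℝ).sum_repr' v
    conv_lhs => rw [← h1]
    refine Finset.sum_congr rfl fun i _ => ?_
    rw [real_inner_comm, EuclideanSpace.inner_basisFun_real]
  have hφ1 : ContDiff ℝ 1 φ := hφ.contDiff.of_le (by exact_mod_cast le_top)
  -- integrability of the pairings
  have hdi : ∀ i, Integrable (fun x => F γ x * fderiv ℝ φ x (e i)) (volume.restrict (ball x₀ R)) := by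
    intro i
    have hc : Continuous fun x => fderiv ℝ φ x (e i) := (hφ1.continuous_fderiv one_ne_zero).clm_apply continuous_const
    obtain ⟨C, hC⟩ := hc.bounded_above_of_compact_support (hφ.hasCompactSupport.fderiv_apply (𝕜 := ℝ) (e i))
    exact (hint γ).mul_bdd hc.aestronglyMeasurable (Eventually.of_forall hC)
  have hpi : ∀ i, Integrable (fun x => F (i :: γ) x * φ x) (volume.restrict (ball x₀ R)) := by
    intro i
    obtain ⟨C, hC⟩ := hφ.contDiff.continuous.bounded_above_of_compact_support hφ.hasCompactSupport
    exact (hint (i :: γ)).mul_bdd hφ.contDiff.continuous.aestronglyMeasurable (Eventually.of_forall hC)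
  -- expand in the frame
  have hL : ∀ x, (fderiv ℝ φ x v) • F γ x = ∑ i, v i * (F γ x * fderiv ℝ φ x (e i)) := by
    intro x
    conv_lhs => rw [hv]
    rw [map_sum, smul_eq_mul, Finset.sum_mul]
    refine Finset.sum_congr rfl fun i _ => ?_
    rw [map_smul, smul_eq_mul]; ring
  have hR : ∀ x, φ x • ((∑ i, F (i :: γ) x • (EuclideanSpace.proj i : EuclideanSpace ℝ (Fin 3) →L[ℝ] ℝ)) v) =
      ∑ i, v i * (F (i :: γ) x * φ x) := by
    intro x
    rw [smul_eq_mul, _root_.sum_apply, Finset.mul_sum]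
    refine Finset.sum_congr rfl fun i _ => ?_
    rw [_root_.smul_apply, smul_eq_mul]
    have : (EuclideanSpace.proj i : EuclideanSpace ℝ (Fin 3) →L[ℝ] ℝ) v = v i := rfl
    rw [this]; ring
  simp_rw [hL, hR]
  rw [coe_B, integral_finsetSum _ fun i _ => (hdi i).const_mul _, integral_finsetSum _ fun i _ => (hpi i).const_mul _,
    ← Finset.sum_neg_distrib]
  refine Finset.sum_congr rfl fun i _ => ?_
  rw [integral_const_mul, integral_const_mul, hweak γ i φ hφ, mul_neg]

/-! ### The mollifiers -/

/-- Bumps of outer radius `δ / (n + 1)` (Evans, *PDE*, App. C.4: the standard mollifiers `η_ε`). [folklore] -/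
def bump (δ : ℝ) (hδ : 0 < δ) (n : ℕ) : ContDiffBump (0 : EuclideanSpace ℝ (Fin 3)) :=
  ⟨δ / (2 * (n + 1)), δ / (n + 1), by positivity, by
    rw [div_lt_div_iff_of_pos_left hδ (by positivity) (by positivity)]; linarith⟩

/-- The outer radius of the bumps. [folklore] -/
theorem bump_rOut (δ : ℝ) (hδ : 0 < δ) (n : ℕ) : (bump δ hδ n).rOut = δ / (n + 1) := rfl

/-- The outer radius is at most `δ`. [folklore] -/
theorem bump_rOut_le (δ : ℝ) (hδ : 0 < δ) (n : ℕ) : (bump δ hδ n).rOut ≤ δ := by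
  rw [bump_rOut]
  exact div_le_self hδ.le (by linarith [n.cast_nonneg (α := ℝ)])

/-- The outer radii tend to zero. [folklore] -/
theorem tendsto_bump_rOut (δ : ℝ) (hδ : 0 < δ) : Tendsto (fun n => (bump δ hδ n).rOut) atTop (𝓝 0) := by
  simp only [bump_rOut]
  have h := (tendsto_one_div_add_atTop_nhds_zero_nat).const_mul δ
  rw [mul_zero] at h
  refine h.congr fun n => ?_
  ring

/-- The mollifications of the zero extensions (Evans, *PDE*, App. C.4, `f^ε = η_ε ⋆ f`). [folklore] -/
def moll (x₀ : EuclideanSpace ℝ (Fin 3)) (R : ℝ) (F : List (Fin 3) → EuclideanSpace ℝ (Fin 3) → ℝ)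
    (δ : ℝ) (hδ : 0 < δ) (n : ℕ) (γ : List (Fin 3)) : EuclideanSpace ℝ (Fin 3) → ℝ :=
  (bump δ hδ n).normed volume ⋆[ContinuousLinearMap.lsmul ℝ ℝ, volume] (ball x₀ R).indicator (F γ)

variable {δ : ℝ} {hδ : 0 < δ}

/-- The mollifications are smooth. [folklore] -/
theorem contDiff_moll (hint : ∀ γ, IntegrableOn (F γ) (ball x₀ R)) (n : ℕ) (γ : List (Fin 3)) :
    ContDiff ℝ ∞ (moll x₀ R F δ hδ n γ) :=
  (bump δ hδ n).hasCompactSupport_normed.contDiff_convolution_left _ (bump δ hδ n).contDiff_normed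
    (((hint γ).integrable_indicator measurableSet_ball).locallyIntegrable)

/-- The mollifications as integrals against the data. [folklore] -/
theorem moll_eq (n : ℕ) (γ : List (Fin 3)) (x : EuclideanSpace ℝ (Fin 3)) :
    moll x₀ R F δ hδ n γ x = ∫ z in ball x₀ R, F γ z * (bump δ hδ n).normed volume (x - z) := by
  rw [moll, LaplaceDivFormMollified.normed_convolution_eq, ← integral_indicator measurableSet_ball]
  refine integral_congr_ae (Eventually.of_forall fun z => ?_)
  by_cases hz : z ∈ ball x₀ R
  · simp [indicator_of_mem hz]
  · simp [indicator_of_notMem hz]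

set_option maxHeartbeats 800000 in
/-- **The mollifications are bounded by the bounds of the data**: `|moll n γ| ≤ K_{|γ|}`. [folklore] -/
theorem abs_moll_le (hint : ∀ γ, IntegrableOn (F γ) (ball x₀ R))
    (hbd : ∀ γ, ∀ᵐ x ∂(volume.restrict (ball x₀ R)), |F γ x| ≤ K γ.length)
    (n : ℕ) (γ : List (Fin 3)) (x : EuclideanSpace ℝ (Fin 3)) :
    |moll x₀ R F δ hδ n γ x| ≤ K γ.length := by
  rw [moll_eq]
  set ψ := (bump δ hδ n).normed (volume : Measure (EuclideanSpace ℝ (Fin 3))) with hψ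
  have hψc : Continuous fun z => ψ (x - z) := (bump δ hδ n).continuous_normed.comp (continuous_const.sub continuous_id)
  obtain ⟨C, hC⟩ := (bump δ hδ n).continuous_normed.bounded_above_of_compact_support
    ((bump δ hδ n).hasCompactSupport_normed (μ := volume))
  have hi : Integrable (fun z => F γ z * ψ (x - z)) (volume.restrict (ball x₀ R)) :=
    (hint γ).mul_bdd hψc.aestronglyMeasurable (Eventually.of_forall fun z => hC _)
  have hi' : Integrable (fun z => (K γ.length : ℝ) * ψ (x - z)) (volume.restrict (ball x₀ R)) := by
    refine Integrable.const_mul ?_ _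
    exact (((bump δ hδ n).integrable_normed (μ := volume)).comp_sub_left x).integrableOn
  calc |∫ z in ball x₀ R, F γ z * ψ (x - z)|
      ≤ ∫ z in ball x₀ R, |F γ z * ψ (x - z)| := abs_integral_le_integral_abs
    _ ≤ ∫ z in ball x₀ R, (K γ.length : ℝ) * ψ (x - z) := by
        refine integral_mono_ae hi.abs hi' ?_
        filter_upwards [hbd γ] with z hz
        rw [abs_mul, abs_of_nonneg ((bump δ hδ n).nonneg_normed _)]
        exact mul_le_mul_of_nonneg_right hz ((bump δ hδ n).nonneg_normed _)
    _ ≤ ∫ z, (K γ.length : ℝ) * ψ (x - z) :=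
        setIntegral_le_integral ((((bump δ hδ n).integrable_normed (μ := volume)).comp_sub_left x).const_mul _)
          (Eventually.of_forall fun z => mul_nonneg (K _).coe_nonneg ((bump δ hδ n).nonneg_normed _))
    _ = K γ.length := by
        rw [integral_const_mul, integral_sub_left_eq_self ψ volume x]
        simp [hψ, (bump δ hδ n).integral_normed]

set_option maxHeartbeats 800000 in
/-- **Mollification commutes with weak differentiation, inside**: for `x` with
`closedBall x δ ⊆ B(x₀, R)`, `∂ᵢ(moll n γ)(x) = moll n (i :: γ) (x)`. [folklore] -/
theorem fderiv_moll_apply (hint : ∀ γ, IntegrableOn (F γ) (ball x₀ R))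
    (hweak : ∀ (γ : List (Fin 3)) (i : Fin 3) (φ : EuclideanSpace ℝ (Fin 3) → ℝ), IsTestFunctionOn (B x₀ R) φ →
      ∫ x in ball x₀ R, F γ x * fderiv ℝ φ x (e i) = -∫ x in ball x₀ R, F (i :: γ) x * φ x)
    (n : ℕ) (γ : List (Fin 3)) {x : EuclideanSpace ℝ (Fin 3)} (hx : closedBall x δ ⊆ ball x₀ R) (i : Fin 3) :
    fderiv ℝ (moll x₀ R F δ hδ n γ) x (e i) = moll x₀ R F δ hδ n (i :: γ) x := by
  have hw := hasWeakFDerivOn_of_coords hint hweak γ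
  have hx' : closedBall x (bump δ hδ n).rOut ⊆ (B x₀ R : Set (EuclideanSpace ℝ (Fin 3))) :=
    (closedBall_subset_closedBall (bump_rOut_le δ hδ n)).trans hx
  have hgi : Integrable (fun y => ∑ i, F (i :: γ) y • (EuclideanSpace.proj i : EuclideanSpace ℝ (Fin 3) →L[ℝ] ℝ))
      (volume.restrict (ball x₀ R)) :=
    integrable_finsetSum Finset.univ
      (f := fun i y => F (i :: γ) y • (EuclideanSpace.proj i : EuclideanSpace ℝ (Fin 3) →L[ℝ] ℝ))
      fun i _ => (hint (i :: γ)).smul_const (EuclideanSpace.proj i : EuclideanSpace ℝ (Fin 3) →L[ℝ] ℝ)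
  have hD := hw.hasFDerivAt_normed_convolution_indicator (hint γ) hgi (bump δ hδ n) hx'
  rw [coe_B] at hD
  rw [moll, hD.fderiv, moll_eq]
  have hint' : ∀ j, Integrable (fun y => (bump δ hδ n).normed volume (x - y) • (F (j :: γ) y •
      (EuclideanSpace.proj j : EuclideanSpace ℝ (Fin 3) →L[ℝ] ℝ))) (volume.restrict (ball x₀ R)) := by
    intro j
    obtain ⟨C, hC⟩ := (bump δ hδ n).continuous_normed.bounded_above_of_compact_support
      ((bump δ hδ n).hasCompactSupport_normed (μ := volume))
    have hc : Continuous fun y => (bump δ hδ n).normed volume (x - y) :=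
      (bump δ hδ n).continuous_normed.comp (continuous_const.sub continuous_id)
    exact ((hint (j :: γ)).smul_const _).bdd_smul C hc.aestronglyMeasurable (Eventually.of_forall fun y => hC _)
  have e1 : (fun y => (bump δ hδ n).normed volume (x - y) • ∑ j, F (j :: γ) y •
      (EuclideanSpace.proj j : EuclideanSpace ℝ (Fin 3) →L[ℝ] ℝ)) = fun y => ∑ j, (bump δ hδ n).normed volume (x - y) •
        (F (j :: γ) y • (EuclideanSpace.proj j : EuclideanSpace ℝ (Fin 3) →L[ℝ] ℝ)) := by
    funext y; rw [Finset.smul_sum]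
  rw [e1, integral_finsetSum _ fun j _ => hint' j, _root_.sum_apply]
  have e2 : ∀ j, (∫ y in ball x₀ R, (bump δ hδ n).normed volume (x - y) • (F (j :: γ) y •
      (EuclideanSpace.proj j : EuclideanSpace ℝ (Fin 3) →L[ℝ] ℝ))) (e i) =
      ∫ y in ball x₀ R, (bump δ hδ n).normed volume (x - y) * F (j :: γ) y * (e i) j := by
    intro j
    rw [ContinuousLinearMap.integral_apply (hint' j) (e i)]
    refine integral_congr_ae (Eventually.of_forall fun y => ?_)
    simp only [_root_.smul_apply, smul_eq_mul]
    show (bump δ hδ n).normed volume (x - y) * (F (j :: γ) y * (e i) j) = _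
    ring
  simp_rw [e2]
  rw [Finset.sum_eq_single i]
  · refine integral_congr_ae (Eventually.of_forall fun y => ?_)
    show (bump δ hδ n).normed volume (x - y) * F (i :: γ) y * (e i) i = F (i :: γ) y * (bump δ hδ n).normed volume (x - y)
    have : (e i) i = 1 := by simp [e]
    rw [this]; ring
  · intro j _ hji
    have hz : ∀ y, (bump δ hδ n).normed volume (x - y) * F (j :: γ) y * (e i) j = 0 := fun y => by
      have : (e i) j = 0 := by simp [e, hji]
      rw [this, mul_zero]
    simp_rw [hz, integral_zero]
  · intro h; exact absurd (Finset.mem_univ i) h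

end Setting


/-! ### Iterated derivatives of the mollifications through the frame -/

section Iterated

variable {x₀ : EuclideanSpace ℝ (Fin 3)} {R : ℝ} {F : List (Fin 3) → EuclideanSpace ℝ (Fin 3) → ℝ} {K : ℕ → ℝ≥0}
  {δ : ℝ} {hδ : 0 < δ}

/-- The frame derivative of a mollification agrees with the next mollification on the open
inner ball `B(x₀, R - δ)`, hence eventually near each of its points. [folklore] -/
theorem fderiv_moll_eventuallyEq (hint : ∀ γ, IntegrableOn (F γ) (ball x₀ R))
    (hweak : ∀ (γ : List (Fin 3)) (i : Fin 3) (φ : EuclideanSpace ℝ (Fin 3) → ℝ), IsTestFunctionOn (B x₀ R) φ →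
      ∫ x in ball x₀ R, F γ x * fderiv ℝ φ x (e i) = -∫ x in ball x₀ R, F (i :: γ) x * φ x)
    (n : ℕ) (γ : List (Fin 3)) (i : Fin 3) {x : EuclideanSpace ℝ (Fin 3)} (hx : x ∈ ball x₀ (R - δ)) :
    (fun y => fderiv ℝ (moll x₀ R F δ hδ n γ) y (e i)) =ᶠ[𝓝 x] moll x₀ R F δ hδ n (i :: γ) := by
  filter_upwards [isOpen_ball.mem_nhds hx] with y hy
  refine fderiv_moll_apply hint hweak n γ ?_ i
  intro z hz
  rw [mem_closedBall] at hz
  rw [mem_ball] at hy ⊢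
  calc dist z x₀ ≤ dist z y + dist y x₀ := dist_triangle _ _ _
    _ < δ + (R - δ) := add_lt_add_of_le_of_lt hz hy
    _ = R := by ring

/-- **Iterated frame derivatives of the mollifications**: on `B(x₀, R - δ)`,
`Dᵏ(moll n γ)(x)(e_{σ₀}, …, e_{σ_{k-1}}) = moll n (ofFn σ ++ γ)(x)`. [folklore] -/
theorem iteratedFDeriv_moll_frame (hint : ∀ γ, IntegrableOn (F γ) (ball x₀ R))
    (hweak : ∀ (γ : List (Fin 3)) (i : Fin 3) (φ : EuclideanSpace ℝ (Fin 3) → ℝ), IsTestFunctionOn (B x₀ R) φ →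
      ∫ x in ball x₀ R, F γ x * fderiv ℝ φ x (e i) = -∫ x in ball x₀ R, F (i :: γ) x * φ x)
    (n : ℕ) : ∀ (k : ℕ) (γ : List (Fin 3)) (σ : Fin k → Fin 3) {x : EuclideanSpace ℝ (Fin 3)}, x ∈ ball x₀ (R - δ) →
      iteratedFDeriv ℝ k (moll x₀ R F δ hδ n γ) x (fun j => e (σ j)) = moll x₀ R F δ hδ n (List.ofFn σ ++ γ) x := by
  intro k
  induction k with
  | zero =>
    intro γ σ x hx
    simp
  | succ k ih =>
    intro γ σ x hx
    rw [iteratedFDeriv_succ_apply_right]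
    have hsm : ContDiff ℝ ∞ (moll x₀ R F δ hδ n γ) := contDiff_moll hint n γ
    -- `D^k (fun y => fderiv (moll γ) y) x (init) (last) = D^k (fun y => fderiv (moll γ) y (e last)) x (init)`
    have h1 : iteratedFDeriv ℝ k (fun y => fderiv ℝ (moll x₀ R F δ hδ n γ) y) x (Fin.init fun j => e (σ j))
        (e (σ (Fin.last k))) =
        iteratedFDeriv ℝ k (fun y => fderiv ℝ (moll x₀ R F δ hδ n γ) y (e (σ (Fin.last k)))) x
          (Fin.init fun j => e (σ j)) := by
      rw [iteratedFDeriv_clm_apply_const_apply (hsm.fderiv_right (m := ∞) le_rfl) (by exact_mod_cast le_top)]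
    rw [h1]
    -- the inner function agrees near `x` with the next mollification
    have h2 := (fderiv_moll_eventuallyEq (hδ := hδ) hint hweak n γ (σ (Fin.last k)) hx).iteratedFDeriv ℝ k
    rw [h2.eq_of_nhds]
    have h3 : (Fin.init fun j => e (σ j)) = fun j : Fin k => e (σ (Fin.castSucc j)) := by
      funext j; rfl
    rw [h3, ih (σ (Fin.last k) :: γ) (fun j => σ (Fin.castSucc j)) hx]
    congr 1
    rw [List.ofFn_succ' σ, List.concat_eq_append, List.append_assoc]
    rfl

/-- Hence **all derivatives of the mollifications of `F []` are bounded**: on `B(x₀, R - δ)`,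
`‖Dᵏ(moll n [])(x)‖ ≤ 3ᵏ K_k`. [folklore] -/
theorem norm_iteratedFDeriv_moll_le (hint : ∀ γ, IntegrableOn (F γ) (ball x₀ R))
    (hbd : ∀ γ, ∀ᵐ x ∂(volume.restrict (ball x₀ R)), |F γ x| ≤ K γ.length)
    (hweak : ∀ (γ : List (Fin 3)) (i : Fin 3) (φ : EuclideanSpace ℝ (Fin 3) → ℝ), IsTestFunctionOn (B x₀ R) φ →
      ∫ x in ball x₀ R, F γ x * fderiv ℝ φ x (e i) = -∫ x in ball x₀ R, F (i :: γ) x * φ x)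
    (n k : ℕ) {x : EuclideanSpace ℝ (Fin 3)} (hx : x ∈ ball x₀ (R - δ)) :
    ‖iteratedFDeriv ℝ k (moll x₀ R F δ hδ n []) x‖ ≤ 3 ^ k * K k := by
  refine (norm_multilinear_le_sum_frame _).trans ?_
  calc ∑ σ : Fin k → Fin 3, |iteratedFDeriv ℝ k (moll x₀ R F δ hδ n []) x (fun j => e (σ j))|
      ≤ ∑ _σ : Fin k → Fin 3, (K k : ℝ) := Finset.sum_le_sum fun σ _ => by
        rw [iteratedFDeriv_moll_frame hint hweak n k [] σ hx]
        have h := abs_moll_le (δ := δ) (hδ := hδ) hint hbd n (List.ofFn σ ++ []) x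
        simpa using h
    _ = 3 ^ k * K k := by
        rw [Finset.sum_const, Finset.card_univ, Fintype.card_fun, Fintype.card_fin, Fintype.card_fin, nsmul_eq_mul]
        push_cast; ring

/-- In particular the mollifications of `F []` are **equi-Lipschitz** on `B(x₀, R - δ)` with
constant `3 K₁`. [folklore] -/
theorem lipschitz_moll (hint : ∀ γ, IntegrableOn (F γ) (ball x₀ R))
    (hbd : ∀ γ, ∀ᵐ x ∂(volume.restrict (ball x₀ R)), |F γ x| ≤ K γ.length)
    (hweak : ∀ (γ : List (Fin 3)) (i : Fin 3) (φ : EuclideanSpace ℝ (Fin 3) → ℝ), IsTestFunctionOn (B x₀ R) φ →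
      ∫ x in ball x₀ R, F γ x * fderiv ℝ φ x (e i) = -∫ x in ball x₀ R, F (i :: γ) x * φ x)
    (n : ℕ) {y y' : EuclideanSpace ℝ (Fin 3)} (hy : y ∈ ball x₀ (R - δ)) (hy' : y' ∈ ball x₀ (R - δ)) :
    ‖moll x₀ R F δ hδ n [] y - moll x₀ R F δ hδ n [] y'‖ ≤ 3 * K 1 * ‖y - y'‖ := by
  have hd : ∀ z ∈ ball x₀ (R - δ), DifferentiableAt ℝ (moll x₀ R F δ hδ n []) z := fun z _ =>
    ((contDiff_moll hint n []).differentiable (by simp)).differentiableAt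
  have hb : ∀ z ∈ ball x₀ (R - δ), ‖fderiv ℝ (moll x₀ R F δ hδ n []) z‖ ≤ 3 * K 1 := by
    intro z hz
    have h := norm_iteratedFDeriv_moll_le (hδ := hδ) hint hbd hweak n 1 hz
    rw [← norm_iteratedFDeriv_one (𝕜 := ℝ)]
    simpa using h
  exact (convex_ball x₀ (R - δ)).norm_image_sub_le_of_norm_fderiv_le hd hb hy' hy

end Iterated


/-! ### The smooth representative -/

section Limit

variable {x₀ : EuclideanSpace ℝ (Fin 3)} {R : ℝ} {F : List (Fin 3) → EuclideanSpace ℝ (Fin 3) → ℝ} {K : ℕ → ℝ≥0}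

/-- A set of full measure in an open ball of positive radius... meets every open ball around a
point of the ball: points of the ball can be approximated by points of the set. [folklore] -/
theorem exists_near_of_ae {D : Set (EuclideanSpace ℝ (Fin 3))}
    (hD : ∀ᵐ x ∂(volume : Measure (EuclideanSpace ℝ (Fin 3))), x ∈ D) {S : Set (EuclideanSpace ℝ (Fin 3))}
    (hS : IsOpen S) {x : EuclideanSpace ℝ (Fin 3)} (hx : x ∈ S) {η : ℝ} (hη : 0 < η) :
    ∃ d ∈ D, d ∈ S ∧ dist d x < η := by
  by_contra h
  have h' : ∀ d ∈ D, d ∈ S → η ≤ dist d x := fun d hd hdS => by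
    by_contra hlt
    exact h ⟨d, hd, hdS, lt_of_not_ge hlt⟩
  have hsub : ball x η ∩ S ⊆ {a | a ∉ D} := fun d hd hdD => (h' d hdD hd.2).not_gt (mem_ball.1 hd.1)
  have hpos : 0 < volume (ball x η ∩ S) :=
    (isOpen_ball.inter hS).measure_pos volume ⟨x, mem_ball_self hη, hx⟩
  have hzero : volume {a | a ∉ D} = 0 := ae_iff.1 hD
  exact (lt_of_lt_of_le hpos ((measure_mono hsub).trans hzero.le)).ne rfl

set_option maxHeartbeats 3200000 in
/-- **Functions with bounded weak derivatives of all orders are smooth, with bounds.** On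
`B(x₀, R)` let `F γ` be integrable, `|F γ| ≤ K_{|γ|}` a.e., with `∫ F γ ∂ᵢφ = -∫ F (i :: γ) φ` for
all test functions `φ` on the ball. Then for `0 < r < R` there is `v`, smooth on `B(x₀, r)` with
`‖Dᵏv‖ ≤ 3ᵏ K_k` there and `3K₁`-Lipschitz, with `F [] = v` a.e. on `B(x₀, r)` (Evans, *PDE*,
§5.3.1 Thm. 1 and §5.8.2; by mollification). [cite: Evans2010, §5.3.1 Thm. 1] -/
theorem exists_smooth_rep {r : ℝ} (hrR : r < R)
    (hint : ∀ γ, IntegrableOn (F γ) (ball x₀ R))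
    (hbd : ∀ γ, ∀ᵐ x ∂(volume.restrict (ball x₀ R)), |F γ x| ≤ K γ.length)
    (hweak : ∀ (γ : List (Fin 3)) (i : Fin 3) (φ : EuclideanSpace ℝ (Fin 3) → ℝ), IsTestFunctionOn (B x₀ R) φ →
      ∫ x in ball x₀ R, F γ x * fderiv ℝ φ x (e i) = -∫ x in ball x₀ R, F (i :: γ) x * φ x) :
    ∃ v : EuclideanSpace ℝ (Fin 3) → ℝ, F [] =ᵐ[volume.restrict (ball x₀ r)] v ∧ ContDiffOn ℝ ∞ v (ball x₀ r) ∧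
      (∀ k, ∀ x ∈ ball x₀ r, ‖iteratedFDeriv ℝ k v x‖ ≤ 3 ^ k * K k) ∧
      ∀ x ∈ ball x₀ r, ∀ y ∈ ball x₀ r, ‖v x - v y‖ ≤ 3 * K 1 * ‖x - y‖ := by
  -- margins
  set δ : ℝ := (R - r) / 2 with hδdef
  have hδ : 0 < δ := by rw [hδdef]; linarith
  have hRδ : R - δ = r + δ := by rw [hδdef]; ring
  have hsub1 : ball x₀ (R - δ) ⊆ ball x₀ R := ball_subset_ball (by linarith)
  have hsubr : ball x₀ r ⊆ ball x₀ (R - δ) := ball_subset_ball (by linarith)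
  set f : ℕ → EuclideanSpace ℝ (Fin 3) → ℝ := fun n => moll x₀ R F δ hδ n [] with hf
  have hfs : ∀ n, ContDiff ℝ ∞ (f n) := fun n => contDiff_moll hint n []
  -- `L²` convergence of the mollifications to the zero extension
  set f₀ : EuclideanSpace ℝ (Fin 3) → ℝ := (ball x₀ R).indicator (F []) with hf₀
  have hmem : MemLp f₀ 2 (volume : Measure (EuclideanSpace ℝ (Fin 3))) := by
    rw [hf₀, memLp_indicator_iff_restrict measurableSet_ball]
    haveI : IsFiniteMeasure ((volume : Measure (EuclideanSpace ℝ (Fin 3))).restrict (ball x₀ R)) :=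
      isFiniteMeasure_restrict.2 measure_ball_lt_top.ne
    refine (memLp_top_of_bound (hint []).aestronglyMeasurable (K 0) ?_).mono_exponent le_top
    exact (hbd []).mono fun x hx => by rw [Real.norm_eq_abs]; simpa using hx
  have hL2 : Tendsto (fun n => eLpNorm (f n - f₀) 2 volume) atTop (𝓝 0) :=
    tendsto_eLpNorm_normed_convolution_sub_self (μ := volume) (tendsto_bump_rOut δ hδ) one_le_two
      (by norm_num) hmem
  have hmeas : TendstoInMeasure volume f atTop f₀ :=
    tendstoInMeasure_of_tendsto_eLpNorm two_ne_zero (fun n => (hfs n).continuous.aestronglyMeasurable) hmem.1 hL2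
  obtain ⟨ns, hns, hae⟩ := hmeas.exists_seq_tendsto_ae
  set g : ℕ → EuclideanSpace ℝ (Fin 3) → ℝ := fun k => f (ns k) with hg
  have hgs : ∀ k, ContDiff ℝ ∞ (g k) := fun k => hfs (ns k)
  have hglip : ∀ k, ∀ y ∈ ball x₀ (R - δ), ∀ y' ∈ ball x₀ (R - δ), ‖g k y - g k y'‖ ≤ 3 * K 1 * ‖y - y'‖ :=
    fun k y hy y' hy' => lipschitz_moll hint hbd hweak (ns k) hy hy'
  have hgbd : ∀ (k i : ℕ), ∀ y ∈ ball x₀ (R - δ), ‖iteratedFDeriv ℝ i (g k) y‖ ≤ 3 ^ i * K i :=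
    fun k i y hy => norm_iteratedFDeriv_moll_le hint hbd hweak (ns k) i hy
  -- pointwise convergence everywhere on `B(x₀, R - δ)`
  set D : Set (EuclideanSpace ℝ (Fin 3)) := {x | Tendsto (fun k => g k x) atTop (𝓝 (f₀ x))} with hD
  have hDae : ∀ᵐ x ∂(volume : Measure (EuclideanSpace ℝ (Fin 3))), x ∈ D := hae
  have hcauchy : ∀ x ∈ ball x₀ (R - δ), CauchySeq fun k => g k x := by
    intro x hx
    rw [Metric.cauchySeq_iff]
    intro ε hε
    have hK1 : 0 ≤ (K 1 : ℝ) := (K 1).coe_nonneg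
    set η : ℝ := ε / (9 * K 1 + 3) with hη
    have hη0 : 0 < η := by rw [hη]; positivity
    obtain ⟨d, hdD, hdB, hdx⟩ := exists_near_of_ae hDae isOpen_ball hx hη0
    have hcd : CauchySeq fun k => g k d := (hdD : Tendsto (fun k => g k d) atTop (𝓝 (f₀ d))).cauchySeq
    rw [Metric.cauchySeq_iff] at hcd
    obtain ⟨N, hN⟩ := hcd (ε / 3) (by positivity)
    refine ⟨N, fun m hm n hn => ?_⟩
    have h1 := hglip m x hx d hdB
    have h2 := hglip n x hx d hdB
    have h3 := hN m hm n hn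
    rw [dist_eq_norm] at h3 ⊢
    have hxd : ‖x - d‖ < η := by rwa [← dist_eq_norm, dist_comm]
    have hb : 3 * K 1 * ‖x - d‖ ≤ ε / 3 := by
      calc 3 * (K 1 : ℝ) * ‖x - d‖ ≤ 3 * K 1 * η := mul_le_mul_of_nonneg_left hxd.le (by positivity)
        _ = ε / 3 * (9 * K 1 / (9 * K 1 + 3)) := by rw [hη]; field_simp; ring
        _ ≤ ε / 3 := by
            refine mul_le_of_le_one_right (by positivity) ?_
            rw [div_le_one (by positivity)]; linarith
    calc ‖g m x - g n x‖ = ‖(g m x - g m d) + (g m d - g n d) + (g n d - g n x)‖ := by congr 1; ring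
      _ ≤ ‖g m x - g m d‖ + ‖g m d - g n d‖ + ‖g n d - g n x‖ := norm_add₃_le
      _ < ε / 3 + ε / 3 + ε / 3 := by
          refine add_lt_add_of_lt_of_le (add_lt_add_of_le_of_lt (h1.trans hb) h3) ?_
          rw [norm_sub_rev]
          exact h2.trans hb
      _ = ε := by ring
  -- the limit
  set v : EuclideanSpace ℝ (Fin 3) → ℝ := fun x => limUnder atTop fun k => g k x with hv
  have hT : ∀ x ∈ ball x₀ (R - δ), Tendsto (fun k => g k x) atTop (𝓝 (v x)) := fun x hx =>
    (hcauchy x hx).tendsto_limUnder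
  refine ⟨v, ?_, ?_⟩
  · -- `F [] = v` a.e. on `B(x₀, r)`
    rw [EventuallyEq, ae_restrict_iff' measurableSet_ball]
    filter_upwards [hDae] with x hxD hxr
    have h1 : Tendsto (fun k => g k x) atTop (𝓝 (f₀ x)) := hxD
    have h2 := hT x (hsubr hxr)
    have := tendsto_nhds_unique h1 h2
    rw [← this, hf₀, indicator_of_mem ((hsubr.trans hsub1) hxr)]
  -- uniform Cauchy on balls of radius `δ` inside
  have hUC : ∀ p ∈ ball x₀ r, UniformCauchySeqOn g atTop (ball p δ) := by
    intro p hp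
    have hpδ : ball p δ ⊆ ball x₀ (R - δ) := by
      rw [hRδ]
      intro y hy
      rw [mem_ball] at hy hp ⊢
      linarith [dist_triangle y p x₀]
    have hsmall := Calculus.eventually_norm_lt_of_equilipschitz (l := (atTop : Filter ℕ) ×ˢ (atTop : Filter ℕ))
      (g := fun i : ℕ × ℕ => fun y => g i.1 y - g i.2 y) (p := p) (R := δ) (L := 3 * K 1 + 3 * K 1)
      (Eventually.of_forall fun i y hy y' hy' => by
        calc ‖(g i.1 y - g i.2 y) - (g i.1 y' - g i.2 y')‖ = ‖(g i.1 y - g i.1 y') - (g i.2 y - g i.2 y')‖ := by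
              congr 1; ring
          _ ≤ ‖g i.1 y - g i.1 y'‖ + ‖g i.2 y - g i.2 y'‖ := norm_sub_le _ _
          _ ≤ 3 * K 1 * ‖y - y'‖ + 3 * K 1 * ‖y - y'‖ :=
              add_le_add (hglip _ y (hpδ hy) y' (hpδ hy')) (hglip _ y (hpδ hy) y' (hpδ hy'))
          _ = (3 * K 1 + 3 * K 1) * ‖y - y'‖ := by ring)
      (fun y hy => by
        have h := ((hT y (hpδ hy)).comp tendsto_fst).sub ((hT y (hpδ hy)).comp tendsto_snd)
        rw [sub_self] at h
        exact h)
    rw [Metric.uniformCauchySeqOn_iff]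
    intro ε hε
    have h := hsmall ε hε
    rw [Filter.prod_atTop_atTop_eq, eventually_atTop_prod_self'] at h
    obtain ⟨N, hN⟩ := h
    exact ⟨N, fun m hm n hn y hy => by rw [dist_eq_norm]; exact hN m hm n hn y hy⟩
  -- smoothness of the limit and convergence of all derivatives
  have hderC : ∀ (i : ℕ), ∀ x ∈ ball x₀ r, ∃ V ∈ 𝓝 x, UniformCauchySeqOn (fun j => iteratedFDeriv ℝ i (g j)) atTop V := by
    intro i x hx
    have hxδ : ball x δ ⊆ ball x₀ (R - δ) := by
      rw [hRδ]
      intro y hy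
      rw [mem_ball] at hy hx ⊢
      linarith [dist_triangle y x x₀]
    refine ⟨ball x (δ / 2 ^ i), isOpen_ball.mem_nhds (mem_ball_self (by positivity)), ?_⟩
    exact Calculus.uniformCauchySeqOn_iteratedFDeriv_of_uniformCauchySeqOn hgs hδ
      (fun k => ⟨3 ^ k * K k, fun j y hy => hgbd j k y (hxδ hy)⟩) (hUC x hx) i
  obtain ⟨hvs, hvconv⟩ := contDiffOn_infty_of_uniformCauchySeqOn_iteratedFDeriv isOpen_ball
    (fun j => (hgs j).contDiffOn) (fun x hx => hT x (hsubr hx)) hderC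
  refine ⟨hvs, fun k x hx => ?_, fun x hx y hy => ?_⟩
  · have ht := (hvconv k).tendsto_at hx
    exact le_of_tendsto ht.norm (Eventually.of_forall fun j => hgbd j k x (hsubr hx))
  · have ht := ((hT x (hsubr hx)).sub (hT y (hsubr hy))).norm
    exact le_of_tendsto ht (Eventually.of_forall fun j => hglip j x (hsubr hx) y (hsubr hy))

end Limit

end WkInfty

end Literature.Analysis.FluidPDE

end
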